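import Summits.AnomalousDissipation.AnomalousDissipation.Theorems.SawtoothPulseCascadeK1LocalisedCascadePhaseTwoStartBoxFibres
import Summits.AnomalousDissipation.AnomalousDissipation.Theorems.SawtoothPulseCascadeK1LocalisedCascadePhaseOneStartBox

/-!
# K1loc, line `Spectral` / thin start — helper: PHASE-TWO START BOX II — the strip `S_1(K)` of `a₁` (Fourier side, series constant abstract)

Helper file of the prover lane on the crux `K1LocalisedCascade` (stmt-AnomalousDissipation-19491), route `SawtoothPulseCascade`
(glue seat; start box of record `StartBoxTwo`, arbiter A23-4…A23-7).  The first link of the start chain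
`S_1(K″) → T_1(K′) → S_2(K_2 = 800)` is the strip `S_1(K) = Σ'[|k₀| < K]‖𝓕a₁‖²` of the explicit iterate `a₁`
(`γ = 8`, `N₀ = 1`, `0 < δ₀ ≤ 2⁻³⁰`).  Road: `[|k₀| < K] ≤ [|k₁| ≤ 1] + [|k₀| < K ∧ 2 ≤ |k₁|]`; the low fibres `|k₁| ≤ 1` are paid
EXACTLY (`…PhaseTwoStartBoxFibres.tsum_lowFibres_sq_norm_phaseOne_le`: `(16/(63π) + ε)² + ε²/2`, no `(u+v)² ≤ 2(u²+v²)` loss),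
the fibres `|k₁| ≥ 2` by the exact-weight start inequality of `…PhaseOneStart` with the window `|k₀ ± 1| ≤ K` on each chirp
(`tsum_weight_chirp_le_lowpass`, `sum_sq_norm_fourierCoeff_exactChirp_le_of_even` at `λ = 8n`, `Q = K < 8|n|`; Bessel `≤ 1` when
`8|n| ≤ K`), termwise dominated by `β_K(m) = [2 ≤ m]·w(m)·min(1, (√L_K(m) + mε)²)`, `L_K(m) = (K+1)(16m/(π(64m² − K²)))²`
(`= 1` if `8m ≤ K`), `w` the weight table of `…ExactChirpSelf`, `ε ≤ 2⁻²⁵` the rounding slope.  Main theorem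
**`phaseOne_strip_le_of_series`**: if `Σ_{m∈T} β_K(m) ≤ B` for every finite `T` (the numeric series, supplied per `K` by
`…PhaseTwoStartBoxSeries`), then `S_1(K) ≤ (16/(63π) + 2⁻²⁵)² + 2⁻⁵¹ + (√(2B) + 2⁻²⁵)²`.
No definitions; nothing about the crux at `δ₀ = ¼`. [cite: Grafakos2014, Prop. 3.1.2 (5) and Prop. 3.2.7 (3)] [problem: turb]
-/

-- `Summit.<Summit>.<Problem>`: single-conjunct summit, the duplicate namespace segment is deliberate.
set_option linter.dupNamespace false

noncomputable section

namespace Summit.AnomalousDissipation.AnomalousDissipation.Theorems.SawtoothPulseCascade.K1Start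

open MeasureTheory Set Filter Topology UnitAddTorus Function Complex AddCircle
open scoped Real
open Literature.Analysis Literature.Analysis.FunctionSpaces Literature.Analysis.FunctionSpaces.Torus Literature.Analysis.FluidPDE
open Literature.Analysis.FluidPDE.ShearStage
open Literature.Analysis.FluidPDE.SawtoothCascade Literature.Analysis.FluidPDE.SawtoothCascade.CascadeParams

/-! ## §1 The termwise majorant and its fold over `ℤ` -/

/-- The termwise majorant `β_K(m)` is nonnegative. [folklore] -/
theorem stripTerm_nonneg (K m : ℕ) (ε : ℝ) :
    0 ≤ (if 2 ≤ m then (1 : ℝ) else 0) *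
      ((if Odd m then (1 / (π * ((8 : ℝ) + m)) + 1 / (π * |(8 : ℝ) - m|)) ^ 2 else if m = 8 then (1 / 4 : ℝ) else 0) *
        min 1 ((Real.sqrt (if 8 * m ≤ K then (1 : ℝ) else
            ((K : ℝ) + 1) * (2 * (8 * (m : ℝ)) / (π * ((8 * (m : ℝ)) ^ 2 - (K : ℝ) ^ 2))) ^ 2) + m * ε) ^ 2)) :=
  mul_nonneg (by split_ifs <;> norm_num) (mul_nonneg (by split_ifs <;> positivity) (le_min zero_le_one (sq_nonneg _)))

/-- **Folding the fibre series over `ℤ`**: a termwise bound `t(n) ≤ β_K(|n|)` and `Σ_{m∈T} β_K(m) ≤ B` for all finite `T ⊆ ℕ` give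
`Σ_{n∈S} t(n) ≤ 2B` for all finite `S ⊆ ℤ` (each `m` has the two preimages `±m`). [folklore] -/
theorem sum_int_le_two_mul_of_natAbs {β : ℕ → ℝ} (hβ0 : ∀ m, 0 ≤ β m) {B : ℝ} (hB : ∀ T : Finset ℕ, ∑ m ∈ T, β m ≤ B)
    {t : ℤ → ℝ} (ht : ∀ n : ℤ, t n ≤ β n.natAbs) (S : Finset ℤ) : ∑ n ∈ S, t n ≤ 2 * B := by
  classical
  have h1 : ∑ n ∈ S, t n ≤ ∑ n ∈ S, β n.natAbs := Finset.sum_le_sum fun n _ => ht n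
  set T := S.image Int.natAbs with hT
  have h2 : ∑ n ∈ S, β n.natAbs = ∑ m ∈ T, ∑ n ∈ S.filter (fun n => n.natAbs = m), β n.natAbs :=
    (Finset.sum_fiberwise_of_maps_to (fun n hn => Finset.mem_image_of_mem _ hn) _).symm
  have h3 : ∀ m ∈ T, ∑ n ∈ S.filter (fun n => n.natAbs = m), β n.natAbs ≤ 2 * β m := by
    intro m _
    have heq : ∑ n ∈ S.filter (fun n => n.natAbs = m), β n.natAbs = ∑ n ∈ S.filter (fun n => n.natAbs = m), β m :=
      Finset.sum_congr rfl fun n hn => by rw [(Finset.mem_filter.1 hn).2]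
    rw [heq, Finset.sum_const, nsmul_eq_mul]
    have hcard : (S.filter (fun n => n.natAbs = m)).card ≤ 2 := by
      have hsub : S.filter (fun n => n.natAbs = m) ⊆ {(m : ℤ), -(m : ℤ)} := by
        intro n hn
        rw [Finset.mem_insert, Finset.mem_singleton]
        have h := (Finset.mem_filter.1 hn).2
        rcases Int.natAbs_eq n with h' | h' <;> [left; right] <;> rw [h', h]
      exact (Finset.card_le_card hsub).trans (Finset.card_le_two)
    have : ((S.filter (fun n => n.natAbs = m)).card : ℝ) ≤ 2 := by exact_mod_cast hcard
    exact mul_le_mul_of_nonneg_right this (hβ0 m)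
  calc ∑ n ∈ S, t n ≤ ∑ m ∈ T, ∑ n ∈ S.filter (fun n => n.natAbs = m), β n.natAbs := h1.trans (le_of_eq h2)
    _ ≤ ∑ m ∈ T, 2 * β m := Finset.sum_le_sum h3
    _ = 2 * ∑ m ∈ T, β m := by rw [Finset.mul_sum]
    _ ≤ 2 * B := by have := hB T; linarith

/-! ## §2 The strip of `a₁` from the numeric series -/

/-- **THE STRIP OF `a₁` AT `γ = 8`, FOURIER SIDE.**  `γ = 8`, `N₀ = 1`, `0 < δ₀ ≤ 2⁻³⁰`, `a₁` the inviscid iterate of the datum,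
`K : ℕ`.  If the numeric series is bounded — `Σ_{m∈T} β_K(m) ≤ B` for every finite `T ⊆ ℕ` and every rounding slope
`0 ≤ ε ≤ 2⁻²⁵`, where `β_K(m) = [2 ≤ m]·w(m)·min(1, (√L_K(m) + mε)²)`, `L_K(m) = (K+1)(16m/(π(64m²−K²)))²` (`1` if `8m ≤ K`) —
then `Σ'[|k₀| < K]‖𝓕a₁‖² ≤ (16/(63π) + 2⁻²⁵)² + (2⁻²⁵)²/2 + (√(2B) + 2⁻²⁵)²`.
[cite: Grafakos2014, Prop. 3.1.2 (5) and Prop. 3.2.7 (3)] -/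
theorem phaseOne_strip_le_of_series (P : CascadeParams) (hγ : P.γ = 8) (hN₀ : P.N₀ = 1) (hδ₀ : 0 < P.δ₀)
    (hδ₀' : P.δ₀ ≤ (2 : ℝ)⁻¹ ^ 30) (hd : 0 < P.d) (a b : ℕ → UnitAddTorus (Fin 2) → ℝ) (h0 : a 0 = datum)
    (hb : b 0 = a 0 ∘ shearMap 0 1 (amp ⟨P.U 0, P.U_periodic 0, P.contDiff_U (P.δ_pos hδ₀ hd 0)⟩ P.γ))
    (hab : a 1 = b 0 ∘ shearMap 1 0 (amp ⟨P.U 0, P.U_periodic 0, P.contDiff_U (P.δ_pos hδ₀ hd 0)⟩ P.γ))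
    (K : ℕ) {B : ℝ}
    (hB : ∀ ε : ℝ, 0 ≤ ε → ε ≤ (2 : ℝ)⁻¹ ^ 25 → ∀ T : Finset ℕ,
      ∑ m ∈ T, (if 2 ≤ m then (1 : ℝ) else 0) *
        ((if Odd m then (1 / (π * ((8 : ℝ) + m)) + 1 / (π * |(8 : ℝ) - m|)) ^ 2 else if m = 8 then (1 / 4 : ℝ) else 0) *
          min 1 ((Real.sqrt (if 8 * m ≤ K then (1 : ℝ) else
            ((K : ℝ) + 1) * (2 * (8 * (m : ℝ)) / (π * ((8 * (m : ℝ)) ^ 2 - (K : ℝ) ^ 2))) ^ 2) + m * ε) ^ 2)) ≤ B) :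
    ∑' k : Fin 2 → ℤ, (if |k 0| < (K : ℤ) then (1 : ℝ) else 0) * ‖mFourierCoeff (fun x => (a 1 x : ℂ)) k‖ ^ 2 ≤
      (16 / (63 * π) + (2 : ℝ)⁻¹ ^ 25) ^ 2 + ((2 : ℝ)⁻¹ ^ 25) ^ 2 / 2 + (Real.sqrt (2 * B) + (2 : ℝ)⁻¹ ^ 25) ^ 2 := by
  classical
  have hπ : 0 < π := Real.pi_pos
  set ψ : ShearProfile := amp ⟨P.U 0, P.U_periodic 0, P.contDiff_U (P.δ_pos hδ₀ hd 0)⟩ P.γ with hψ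
  have hψt : ∀ t : ℝ, ψ t = 8 * P.U 0 t := fun t => by rw [hψ, amp_apply, hγ]
  have hN0 : P.N 0 = 1 := by simp [CascadeParams.N, hN₀]
  have hδ0 : P.δ 0 = P.δ₀ := by simp [CascadeParams.δ]
  -- the rounding
  set η₁ : ℝ := 8 * ((2 * Real.exp (1 / 2) - 1) * P.δ₀ / (2 * π)) with hη₁
  have hU : ∀ y : ℝ, |P.U 0 y - tri (2 * π * y) / (2 * π)| ≤ (2 * Real.exp (1 / 2) - 1) * P.δ₀ / (2 * π) := by
    intro y
    have h := abs_U_sub_exactProfile_le P hδ₀ hd (j := 0) (by rw [hN0]; exact one_pos) y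
    rw [hN0, hδ0] at h
    simpa using h
  have hη : ∀ t : ℝ, |ψ t - (8 : ℤ) * (tri (2 * π * t) / (2 * π))| ≤ η₁ := by
    intro t
    rw [hψt, show ((8 : ℤ) : ℝ) = 8 by norm_num, ← mul_sub, abs_mul, abs_of_pos (by norm_num : (0:ℝ) < 8), hη₁]
    exact mul_le_mul_of_nonneg_left (hU t) (by norm_num)
  set ε : ℝ := 2 * π * η₁ with hεdef
  have hεval : ε = 8 * (2 * Real.exp (1 / 2) - 1) * P.δ₀ := by rw [hεdef, hη₁]; field_simp
  have hε0 : 0 ≤ ε := by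
    rw [hεval]
    have h : 0 ≤ 2 * Real.exp (1 / 2) - 1 := by linarith [Real.add_one_le_exp (1 / 2 : ℝ)]
    exact mul_nonneg (mul_nonneg (by norm_num) h) hδ₀.le
  have hε : ε ≤ (2 : ℝ)⁻¹ ^ 25 := by rw [hεval]; exact rounding_slope_le hδ₀.le hδ₀'
  -- the iterate and its coefficients
  have hb' : b 0 = datum ∘ shearMap 0 1 ψ := by rw [hb, h0]
  have ha' : a 1 = b 0 ∘ shearMap 1 0 ψ := hab
  have hac : Continuous fun x => (a 1 x : ℂ) := by
    rw [ha', hb']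
    exact Complex.continuous_ofReal.comp
      ((isSmooth_datum_comp_shearMap ψ).continuous.comp (continuous_shearMap 1 0 ψ))
  set c : (Fin 2 → ℤ) → ℝ := fun k => ‖mFourierCoeff (fun x => (a 1 x : ℂ)) k‖ ^ 2 with hc
  have hcs : Summable c := (hasSum_sq_mFourierCoeff_of_continuous hac).summable
  have hc0 : ∀ k, 0 ≤ c k := fun k => sq_nonneg _
  -- the two weights
  set W₁ : (Fin 2 → ℤ) → ℝ := fun k => if |k 1| ≤ 1 then (1 : ℝ) else 0 with hW₁
  set W₂ : (Fin 2 → ℤ) → ℝ := fun k => if |k 0| < (K : ℤ) ∧ 2 ≤ |k 1| then (1 : ℝ) else 0 with hW₂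
  have hW20 : ∀ k, 0 ≤ W₂ k := fun k => by simp only [hW₂]; split_ifs <;> norm_num
  have hW21 : ∀ k, W₂ k ≤ 1 := fun k => by simp only [hW₂]; split_ifs <;> norm_num
  have hind : ∀ k : Fin 2 → ℤ, (if |k 0| < (K : ℤ) then (1 : ℝ) else 0) ≤ W₁ k + W₂ k := by
    intro k
    simp only [hW₁, hW₂]
    by_cases h1 : |k 1| ≤ 1
    · rw [if_pos h1]; split_ifs <;> norm_num
    · rw [if_neg h1]
      have h2 : 2 ≤ |k 1| := by omega
      by_cases h0 : |k 0| < (K : ℤ)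
      · rw [if_pos h0, if_pos ⟨h0, h2⟩]; norm_num
      · rw [if_neg h0, if_neg (fun h => h0 h.1)]; norm_num
  have hI : ∀ (w : (Fin 2 → ℤ) → ℝ), (∀ k, 0 ≤ w k) → (∀ k, w k ≤ 1) → Summable fun k => w k * c k := fun w hw0 hw1 =>
    Summable.of_nonneg_of_le (fun k => mul_nonneg (hw0 k) (hc0 k)) (fun k => mul_le_of_le_one_left (hc0 k) (hw1 k)) hcs
  have hW10 : ∀ k, 0 ≤ W₁ k := fun k => by simp only [hW₁]; split_ifs <;> norm_num
  have hW11 : ∀ k, W₁ k ≤ 1 := fun k => by simp only [hW₁]; split_ifs <;> norm_num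
  have hsplit : ∑' k : Fin 2 → ℤ, (if |k 0| < (K : ℤ) then (1 : ℝ) else 0) * c k ≤
      ∑' k, W₁ k * c k + ∑' k, W₂ k * c k := by
    rw [← (hI W₁ hW10 hW11).tsum_add (hI W₂ hW20 hW21)]
    refine Summable.tsum_le_tsum (fun k => ?_) (hI _ (fun k => by split_ifs <;> norm_num) (fun k => by split_ifs <;> norm_num))
      ((hI W₁ hW10 hW11).add (hI W₂ hW20 hW21))
    rw [← add_mul]
    exact mul_le_mul_of_nonneg_right (hind k) (hc0 k)
  -- the low fibres, exactly
  have hlow : ∑' k, W₁ k * c k ≤ (16 / (63 * π) + (2 : ℝ)⁻¹ ^ 25) ^ 2 + ((2 : ℝ)⁻¹ ^ 25) ^ 2 / 2 := by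
    have h := tsum_lowFibres_sq_norm_phaseOne_le ψ hb' ha' hη
    have h1 : (16 / (63 * π) + 2 * π * η₁) ^ 2 ≤ (16 / (63 * π) + (2 : ℝ)⁻¹ ^ 25) ^ 2 := by
      rw [← hεdef]
      exact pow_le_pow_left₀ (by positivity) (by linarith) 2
    have h2 : (2 * π * η₁) ^ 2 / 2 ≤ ((2 : ℝ)⁻¹ ^ 25) ^ 2 / 2 := by
      rw [← hεdef]
      exact div_le_div_of_nonneg_right (pow_le_pow_left₀ hε0 hε 2) (by norm_num)
    exact h.trans (add_le_add h1 h2)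
  -- the fibres `|k₁| ≥ 2`: the exact-weight start inequality
  obtain ⟨gp, hgpc, hgp⟩ := exists_exactChirp 8
  obtain ⟨gm, hgmc, hgm⟩ := exists_exactChirp (-8)
  have hgm' : ∀ t : ℝ, gm (t : UnitAddCircle) =
      Complex.exp (-(2 * π * I * (-(8 : ℤ)) * ((tri (2 * π * t) / (2 * π) : ℝ) : ℂ))) := fun t => by
    rw [hgm t, Int.cast_neg]
  have hmain := tsum_weight_sq_norm_phaseOne_le_exact ψ hb' ha' hW20 hW21 8 hgp hgm' hgpc hgmc hη
  -- the termwise majorant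
  set βK : ℕ → ℝ := fun m => (if 2 ≤ m then (1 : ℝ) else 0) *
    ((if Odd m then (1 / (π * ((8 : ℝ) + m)) + 1 / (π * |(8 : ℝ) - m|)) ^ 2 else if m = 8 then (1 / 4 : ℝ) else 0) *
      min 1 ((Real.sqrt (if 8 * m ≤ K then (1 : ℝ) else
        ((K : ℝ) + 1) * (2 * (8 * (m : ℝ)) / (π * ((8 * (m : ℝ)) ^ 2 - (K : ℝ) ^ 2))) ^ 2) + m * ε) ^ 2)) with hβK
  have hβ0 : ∀ m, 0 ≤ βK m := fun m => stripTerm_nonneg K m ε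
  have hdom : ∀ (c' : ℤ), (c' = 1 ∨ c' = -1) → ∀ {g : UnitAddCircle → ℂ} (lam : ℤ), (lam = 8 ∨ lam = -8) →
      (∀ t : ℝ, g (t : UnitAddCircle) = Complex.exp (-(2 * π * I * lam * ((tri (2 * π * t) / (2 * π) : ℝ) : ℂ)))) →
      Continuous g → ∀ n : ℤ,
      ‖fourierCoeff g n‖ ^ 2 * ∑' p : ℤ, W₂ (![p, n]) * ‖fourierCoeff (twist ψ n) (p + c')‖ ^ 2 ≤ βK n.natAbs := by
    intro c' hc' g lam hlam hg hgc n
    have hw := sq_norm_fourierCoeff_exactChirp_eight_le hlam hg hgc n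
    have hΦ1 : ∑' p : ℤ, W₂ (![p, n]) * ‖fourierCoeff (twist ψ n) (p + c')‖ ^ 2 ≤ 1 :=
      tsum_weight_chirp_le_one ψ n c' hW20 hW21
    have hΦ0 : 0 ≤ ∑' p : ℤ, W₂ (![p, n]) * ‖fourierCoeff (twist ψ n) (p + c')‖ ^ 2 :=
      tsum_nonneg fun p => mul_nonneg (hW20 _) (sq_nonneg _)
    have hm : (n.natAbs : ℝ) = |(n : ℝ)| := (Nat.cast_natAbs n).trans (Int.cast_abs)
    have hwN := weightTable_le_natAbs n
    have hwN0 : 0 ≤ (if Odd n.natAbs then (1 / (π * ((8 : ℝ) + n.natAbs)) + 1 / (π * |(8 : ℝ) - n.natAbs|)) ^ 2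
          else if n.natAbs = 8 then (1 / 4 : ℝ) else 0) := by split_ifs <;> positivity
    by_cases hn2 : 2 ≤ n.natAbs
    · -- fibres `|n| ≥ 2`
      simp only [hβK, if_pos hn2, one_mul]
      have hn : n ≠ 0 := by intro h; rw [h] at hn2; simp at hn2
      -- the window functional, capped
      have hΦ : ∑' p : ℤ, W₂ (![p, n]) * ‖fourierCoeff (twist ψ n) (p + c')‖ ^ 2 ≤
          min 1 ((Real.sqrt (if 8 * n.natAbs ≤ K then (1 : ℝ) else
            ((K : ℝ) + 1) * (2 * (8 * (n.natAbs : ℝ)) / (π * ((8 * (n.natAbs : ℝ)) ^ 2 - (K : ℝ) ^ 2))) ^ 2) +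
              n.natAbs * ε) ^ 2) := by
        refine le_min hΦ1 ?_
        by_cases hK8 : 8 * n.natAbs ≤ K
        · rw [if_pos hK8, Real.sqrt_one]
          have h0' : (0 : ℝ) ≤ n.natAbs * ε := by positivity
          have h1 : (1 : ℝ) ≤ 1 + n.natAbs * ε := by linarith
          have : (1 : ℝ) ≤ (1 + n.natAbs * ε) ^ 2 := by nlinarith
          exact hΦ1.trans this
        · rw [if_neg hK8]
          push Not at hK8
          -- the window sits in `|p + c'| ≤ K`
          have hsupp : ∀ p : ℤ, W₂ (![p, n]) ≠ 0 → |p + c'| ≤ (K : ℤ) := by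
            intro p hp
            simp only [hW₂, Matrix.cons_val_zero] at hp
            by_cases h : |p| < (K : ℤ) ∧ 2 ≤ |(![p, n] : Fin 2 → ℤ) 1|
            · rcases hc' with rfl | rfl
              · have := abs_add_le p 1; simp only [abs_one] at this; omega
              · have := abs_add_le p (-1); simp only [abs_neg, abs_one] at this; omega
            · exact absurd (by rw [if_neg h]) hp
          have hlow := tsum_weight_chirp_le_lowpass ψ n c' hW21 hsupp
          -- the exact chirp of frequency `8n` in the window `|q| ≤ K`
          obtain ⟨g8, hg8c, hg8⟩ := exists_exactChirp (8 * n)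
          have hev8 : Even (8 * n) := ⟨4 * n, by ring⟩
          have hQ : (K : ℤ) < |8 * n| := by
            rw [abs_mul, abs_of_pos (by norm_num : (0:ℤ) < 8), ← Int.natCast_natAbs]
            exact_mod_cast hK8
          have hL := sum_sq_norm_fourierCoeff_exactChirp_le_of_even hev8 hg8 hg8c hQ
          have hL' : ∑ q ∈ Finset.Icc (-(K : ℤ)) K, ‖fourierCoeff g8 q‖ ^ 2 ≤
              ((K : ℝ) + 1) * (2 * (8 * (n.natAbs : ℝ)) / (π * ((8 * (n.natAbs : ℝ)) ^ 2 - (K : ℝ) ^ 2))) ^ 2 := by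
            refine hL.trans (le_of_eq ?_)
            have e1 : |((8 * n : ℤ) : ℝ)| = 8 * (n.natAbs : ℝ) := by
              rw [hm]; push_cast; rw [abs_mul, abs_of_pos (by norm_num : (0:ℝ) < 8)]
            have e2 : ((8 * n : ℤ) : ℝ) ^ 2 = (8 * (n.natAbs : ℝ)) ^ 2 := by
              rw [← sq_abs, e1]
            rw [e1, e2]
          -- rounding
          have hηn : ∀ t : ℝ, |n * ψ t - ((8 * n : ℤ)) * (tri (2 * π * t) / (2 * π))| ≤ |(n : ℝ)| * η₁ := by
            intro t
            have e : (n : ℝ) * ψ t - ((8 * n : ℤ) : ℝ) * (tri (2 * π * t) / (2 * π)) =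
                n * (ψ t - (8 : ℤ) * (tri (2 * π * t) / (2 * π))) := by push_cast; ring
            rw [e, abs_mul]
            exact mul_le_mul_of_nonneg_left (hη t) (abs_nonneg _)
          have hR := sqrt_sum_sq_norm_fourierCoeff_twist_le ψ n (8 * n) hg8 hg8c hηn (Finset.Icc (-(K : ℤ)) K)
          have hεn : 2 * π * (|(n : ℝ)| * η₁) = n.natAbs * ε := by rw [hm, hεdef]; ring
          set Lr : ℝ := ((K : ℝ) + 1) * (2 * (8 * (n.natAbs : ℝ)) / (π * ((8 * (n.natAbs : ℝ)) ^ 2 - (K : ℝ) ^ 2))) ^ 2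
            with hLr
          have hX0 : 0 ≤ Real.sqrt Lr + n.natAbs * ε := by positivity
          have hS0 : 0 ≤ ∑ q ∈ Finset.Icc (-(K : ℤ)) K, ‖fourierCoeff (twist ψ n) q‖ ^ 2 :=
            Finset.sum_nonneg fun q _ => sq_nonneg _
          have hS : ∑ q ∈ Finset.Icc (-(K : ℤ)) K, ‖fourierCoeff (twist ψ n) q‖ ^ 2 ≤ (Real.sqrt Lr + n.natAbs * ε) ^ 2 := by
            rw [← Real.sq_sqrt hS0]
            refine pow_le_pow_left₀ (Real.sqrt_nonneg _) ?_ 2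
            rw [← hεn]
            exact hR.trans (by linarith [Real.sqrt_le_sqrt hL'])
          exact hlow.trans hS
      have hmin0 : 0 ≤ min 1 ((Real.sqrt (if 8 * n.natAbs ≤ K then (1 : ℝ) else
            ((K : ℝ) + 1) * (2 * (8 * (n.natAbs : ℝ)) / (π * ((8 * (n.natAbs : ℝ)) ^ 2 - (K : ℝ) ^ 2))) ^ 2) +
              n.natAbs * ε) ^ 2) := le_min zero_le_one (sq_nonneg _)
      exact mul_le_mul (hw.trans hwN) hΦ hΦ0 hwN0
    · -- fibres `|n| ≤ 1`: the window is empty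
      simp only [hβK, if_neg hn2, zero_mul]
      have hzero : ∑' p : ℤ, W₂ (![p, n]) * ‖fourierCoeff (twist ψ n) (p + c')‖ ^ 2 = 0 := by
        have hfun : (fun p : ℤ => W₂ (![p, n]) * ‖fourierCoeff (twist ψ n) (p + c')‖ ^ 2) = fun _ => 0 := by
          funext p
          have : W₂ (![p, n]) = 0 := by
            simp only [hW₂]
            rw [if_neg]
            intro h
            have h2 : 2 ≤ |n| := by simpa using h.2
            have h3 : ((2 : ℕ) : ℤ) ≤ (n.natAbs : ℤ) := by rw [Int.natCast_natAbs]; exact_mod_cast h2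
            exact hn2 (by exact_mod_cast h3)
          rw [this, zero_mul]
        rw [hfun, tsum_zero]
      rw [hzero, mul_zero]
  -- the two fibre series are at most `2B`
  have hBε := hB ε hε0 hε
  have hSm : ∑' n : ℤ, ‖fourierCoeff gm n‖ ^ 2 * ∑' p : ℤ, W₂ (![p, n]) * ‖fourierCoeff (twist ψ n) (p + 1)‖ ^ 2 ≤ 2 * B :=
    Real.tsum_le_of_sum_le (fun n => mul_nonneg (sq_nonneg _) (tsum_nonneg fun p => mul_nonneg (hW20 _) (sq_nonneg _)))
      (sum_int_le_two_mul_of_natAbs hβ0 hBε (hdom 1 (Or.inl rfl) (-8) (Or.inr rfl) hgm hgmc))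
  have hSp : ∑' n : ℤ, ‖fourierCoeff gp n‖ ^ 2 * ∑' p : ℤ, W₂ (![p, n]) * ‖fourierCoeff (twist ψ n) (p - 1)‖ ^ 2 ≤ 2 * B := by
    have h := Real.tsum_le_of_sum_le (fun n => mul_nonneg (sq_nonneg _) (tsum_nonneg fun p => mul_nonneg (hW20 _) (sq_nonneg _)))
      (sum_int_le_two_mul_of_natAbs hβ0 hBε (hdom (-1) (Or.inr rfl) 8 (Or.inl rfl) hgp hgpc))
    simpa only [← sub_eq_add_neg] using h
  have hA : (Real.sqrt (∑' n : ℤ, ‖fourierCoeff gm n‖ ^ 2 *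
      ∑' p : ℤ, W₂ (![p, n]) * ‖fourierCoeff (twist ψ n) (p + 1)‖ ^ 2) + 2 * π * η₁) ^ 2 ≤
      (Real.sqrt (2 * B) + (2 : ℝ)⁻¹ ^ 25) ^ 2 :=
    pow_le_pow_left₀ (by rw [← hεdef]; positivity) (add_le_add (Real.sqrt_le_sqrt hSm) (by rw [← hεdef]; exact hε)) 2
  have hB' : (Real.sqrt (∑' n : ℤ, ‖fourierCoeff gp n‖ ^ 2 *
      ∑' p : ℤ, W₂ (![p, n]) * ‖fourierCoeff (twist ψ n) (p - 1)‖ ^ 2) + 2 * π * η₁) ^ 2 ≤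
      (Real.sqrt (2 * B) + (2 : ℝ)⁻¹ ^ 25) ^ 2 :=
    pow_le_pow_left₀ (by rw [← hεdef]; positivity) (add_le_add (Real.sqrt_le_sqrt hSp) (by rw [← hεdef]; exact hε)) 2
  have hhigh : ∑' k, W₂ k * c k ≤ (Real.sqrt (2 * B) + (2 : ℝ)⁻¹ ^ 25) ^ 2 := by
    refine hmain.trans ?_
    linarith [hA, hB']
  exact hsplit.trans (add_le_add hlow hhigh)

end Summit.AnomalousDissipation.AnomalousDissipation.Theorems.SawtoothPulseCascade.K1Start
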